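import Summits.HodgeConjecture.HodgeConjecture.Theorems.Ring2WeilCoverageCyclotomicUnitProducts
import HarnessLib

/-!
# Weil-type family coverage — THEOREM L (ii) from SIGN-VECTOR WITNESSES, every level `n`: if for each unit residue
# `s ≠ ±1` some signed product of the units `ζ^h(1 − ζ^a)(1 − ζ^b)` is negative exactly at the places `{±1, ±s}`,
# then EVERY even sign pattern on every CM type is a real unit's, and the census's YES verdicts follow

research route conditional on HC_CM; not a corollary; Q11.4-sentence-2 already refuted in dim ≥ 3.

Ring 2, WEIL-TYPE FAMILY-COVERAGE CENSUS (`HOME/WEIL-FAMILY-COVERAGE.md` `## b01`, blocks b01.23 (A) / b01.28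
THEOREM L (ii) «`Sig(E⁺)` ⊇ the even-weight hyperplane at the `h = 1` levels `21, 28, 33, 36, 40, 44, 48, 60, 84`»,
owner ring2-b01), part 14 of the `Ring2WeilCoverage*` series.  Part 7 (`…CyclotomicPrincipalObstruction`) proved
the census's YES verdicts modulo the hypothesis `hU'` «every even sign pattern on `Φ` is a real unit's»; part 13
(`…CyclotomicUnitProducts`) provided, at every level, real units `u(x) = ζ^h(1 − ζ^a)(1 − ζ^b)` whose sign at the
place reading the unit residue `t` is the decidable predicate `negAt x t := (n < at mod 2n ↔ n < bt mod 2n)`.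
This file reduces `hU'` to a finite WITNESS PROPERTY of the level, checkable by `decide` (parts 15 ff.):

  `(W)` for every unit residue `s ∉ {1, −1}` there are a finite set `A` of admissible triples and a sign `ε` with
  `#{x ∈ A : negAt x t} + [ε]` odd EXACTLY for `t ∈ {1, −1, s, −s}` (all unit residues `t`).

* §1 (combinatorics on `ℤ/n`, no number field) `card_filter_symmDiff_add` and `pat_symmDiff`: the pattern of
  `(A ∆ B, ε ⊻ ε′)` is the XOR of the patterns — sign vectors of products ADD; `exists_pattern_pair`: under `(W)`,
  `{±t₁, ±t₂}` is a pattern for distinct non-opposite units; **`exists_pattern_of_witnesses`: under `(W)`, for every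
  CM type set `T` and every `J ⊆ T` of EVEN size, some `(A, ε)` has pattern `{t : t ∈ J ∨ −t ∈ J}`** (induction on
  `|J|`, peeling pairs; the CM-type-set axiom `t ∈ T ↔ −t ∉ T` keeps the pieces disjoint).
* §2 (the number field `K = ℚ(ζₙ)`) **`exists_units_sign_eq` = THEOREM L (ii) from `(W)`**: for every CM type `Φ`
  and every `S ⊆ Φ` with `|S|` even there is a unit `u ∈ 𝓞 K` fixed by `ρ` with `Re φ(u) < 0 ↔ φ ∈ S` on `Φ`
  (`u = ± ∏_{x∈A} u(x)` from part 13, `J` = the residues read by `S`); and **`exists_principal_of_witnesses`**: `(W)`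
  + `Φ` balanced for a CM type set `N_K` with `n₋` EVEN ⟹ `∃ ζ′, ζ′^ρ = −ζ′ ∧ (∀ φ ∈ Φ, Im φ(ζ′) > 0) ∧
  CMTypeLattice.IsOfType 1 ζ′ ⊤` — the principal CM torus `ℂ^Φ/Φ(ℤ[ζₙ])` carries an `ι`-compatible principal
  polarisation (part 7's `exists_principal_of_even` with `hU'` discharged).

HONEST FRAMING: `(W)` is a hypothesis here (discharged per level by `decide` in parts 15 ff.); statements about
Shimura's divisors of principal type on the principal CM torus; nothing about Hodge classes, `W_K`, general members
or HC; `HC_CM` is used nowhere.  No `def`, no named fact, no `sorry`.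

References: [cite: Shimura1998, §14.3 Prop. 4–5, pp. 103–104]; [cite: Washington1997, §8.1]; census b01.23 (A) /
b01.28 THEOREM L (seat-derived).
-/

noncomputable section

open Polynomial NumberField Complex Finset
open scoped Real nonZeroDivisors symmDiff

namespace Summit.HodgeConjecture.Ring2WeilCoverage.CyclotomicUnitSignatures

open Literature.AlgebraicGeometry.Motives (CMType)
open Literature.AlgebraicGeometry.HodgeTheory (IsCMTypeSet)
open Literature.AlgebraicGeometry.ComplexMultiplication.CyclotomicCMType
  (exists_apply_eq_toCircle embedding_eq_of_apply_eq isCMTypeSet_residueFilter)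
open Literature.NumberTheory.ComplexMultiplication
open Summit.HodgeConjecture.Ring2WeilCoverage.CyclotomicUnitProducts
open Summit.HodgeConjecture.Ring2WeilCoverage.CyclotomicPrincipalObstruction (exists_principal_of_even)

variable {n : ℕ} [NeZero n]

/-- `𝐞(t) = exp(2πi t/n) ∈ ℂ` (`ZMod.toCircle`). -/
local notation3 (prettyPrint := false) "𝐞 " t:max => ((ZMod.toCircle t : Circle) : ℂ)

/-- the sign predicate of `u(x) = ζ^h(1 − ζ^a)(1 − ζ^b)`, `x = (a, b, h)`, at the unit residue `t` (part 13). -/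
local notation3 (prettyPrint := false) "negAt " x:max t:max =>
  (n < (x : ℕ × ℕ × ℕ).1 * ZMod.val t % (2 * n) ↔ n < (x : ℕ × ℕ × ℕ).2.1 * ZMod.val t % (2 * n))

/-- the sign pattern of the signed product `(A, ε)` at `t`: `#{x ∈ A : negAt x t} + [ε]` is odd. -/
local notation3 (prettyPrint := false) "pat " A:max ε:max t:max =>
  Odd ((Finset.filter (fun x : ℕ × ℕ × ℕ => negAt x t) A).card + (if (ε : Bool) then 1 else 0))

/-- admissibility of a triple `x = (a, b, h)` (part 13). -/
local notation3 (prettyPrint := false) "Adm " x:max =>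
  (¬ n ∣ (x : ℕ × ℕ × ℕ).1 ∧ ¬ n ∣ (x : ℕ × ℕ × ℕ).2.1 ∧
    (2 * (x : ℕ × ℕ × ℕ).2.2 + (x : ℕ × ℕ × ℕ).1 + (x : ℕ × ℕ × ℕ).2.1) % (2 * n) = 0 ∧
    ¬ IsPrimePow (n / Nat.gcd n (x : ℕ × ℕ × ℕ).1) ∧ ¬ IsPrimePow (n / Nat.gcd n (x : ℕ × ℕ × ℕ).2.1))

/-- the witness property `(W)` of the level `n`. -/
local notation3 (prettyPrint := false) "WitnessProperty" =>
  (∀ s : ZMod n, s.val.Coprime n → s ≠ 1 → s ≠ -1 →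
    ∃ A : Finset (ℕ × ℕ × ℕ), ∃ ε : Bool, (∀ x ∈ A, Adm x) ∧
      ∀ t : ZMod n, t.val.Coprime n → (pat A ε t ↔ (t = 1 ∨ t = -1 ∨ t = s ∨ t = -s)))

/-! ### §1 Patterns add under symmetric difference; even subsets of a CM type set are patterns -/

/-- `#((A ∆ B).filter p) + 2·#((A ∩ B).filter p) = #(A.filter p) + #(B.filter p)`.
research route conditional on HC_CM; not a corollary; Q11.4-sentence-2 already refuted in dim ≥ 3. [folklore] -/
theorem card_filter_symmDiff_add {α : Type*} [DecidableEq α] (A B : Finset α) (p : α → Prop) [DecidablePred p] :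
    ((A ∆ B).filter p).card + 2 * ((A ∩ B).filter p).card = (A.filter p).card + (B.filter p).card := by
  have hA : (A.filter p).card = ((A \ B).filter p).card + ((A ∩ B).filter p).card := by
    rw [← Finset.card_union_of_disjoint (Finset.disjoint_filter_filter (Finset.disjoint_sdiff_inter A B)),
      ← Finset.filter_union, Finset.sdiff_union_inter]
  have hB : (B.filter p).card = ((B \ A).filter p).card + ((A ∩ B).filter p).card := by
    rw [Finset.inter_comm, ← Finset.card_union_of_disjoint
      (Finset.disjoint_filter_filter (Finset.disjoint_sdiff_inter B A)), ← Finset.filter_union,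
      Finset.sdiff_union_inter]
  have hD : ((A ∆ B).filter p).card = ((A \ B).filter p).card + ((B \ A).filter p).card := by
    rw [symmDiff_def, Finset.sup_eq_union, Finset.filter_union,
      Finset.card_union_of_disjoint (Finset.disjoint_filter_filter disjoint_sdiff_sdiff)]
  omega

omit [NeZero n] in
/-- **Patterns ADD**: the pattern of `(A ∆ B, ε ⊻ ε′)` at `t` is the XOR of the patterns of `(A, ε)` and `(B, ε′)`
(the sign vector of a product of units is the sum of the sign vectors).
research route conditional on HC_CM; not a corollary; Q11.4-sentence-2 already refuted in dim ≥ 3. [folklore] -/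
theorem pat_symmDiff (A B : Finset (ℕ × ℕ × ℕ)) (ε ε' : Bool) (t : ZMod n) :
    pat (A ∆ B) (xor ε ε') t ↔ ((pat A ε t ∧ ¬ pat B ε' t) ∨ (pat B ε' t ∧ ¬ pat A ε t)) := by
  have key := card_filter_symmDiff_add A B (fun x : ℕ × ℕ × ℕ => negAt x t)
  simp only [Nat.odd_iff]
  cases ε <;> cases ε' <;>
    simp only [Bool.false_xor, Bool.true_xor, Bool.not_false, Bool.not_true, Bool.false_eq_true, if_true,
      if_false] <;> omega

omit [NeZero n] in
/-- Admissibility passes to symmetric differences.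
research route conditional on HC_CM; not a corollary; Q11.4-sentence-2 already refuted in dim ≥ 3. [folklore] -/
theorem adm_symmDiff {A B : Finset (ℕ × ℕ × ℕ)} (hA : ∀ x ∈ A, Adm x) (hB : ∀ x ∈ B, Adm x) :
    ∀ x ∈ A ∆ B, Adm x := by
  intro x hx
  rw [Finset.mem_symmDiff] at hx
  rcases hx with ⟨h, -⟩ | ⟨h, -⟩
  · exact hA x h
  · exact hB x h

omit [NeZero n] in
/-- The empty product has the empty pattern.
research route conditional on HC_CM; not a corollary; Q11.4-sentence-2 already refuted in dim ≥ 3. [folklore] -/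
theorem not_pat_empty (t : ZMod n) : ¬ pat (∅ : Finset (ℕ × ℕ × ℕ)) false t := by
  simp

omit [NeZero n] in
/-- **Pairs are patterns**: under `(W)`, for unit residues `t₁, t₂` with `t₂ ≠ t₁`, `t₂ ≠ −t₁` there is an
admissible signed product negative exactly at `{t₁, −t₁, t₂, −t₂}` (if one of them is `±1` the other's witness
serves; otherwise the symmetric difference of the two witnesses).
research route conditional on HC_CM; not a corollary; Q11.4-sentence-2 already refuted in dim ≥ 3. [folklore] -/
theorem exists_pattern_pair (hW : WitnessProperty) {t₁ t₂ : ZMod n} (h₁ : t₁.val.Coprime n)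
    (h₂ : t₂.val.Coprime n) (hne : t₂ ≠ t₁) (hne' : t₂ ≠ -t₁) :
    ∃ A : Finset (ℕ × ℕ × ℕ), ∃ ε : Bool, (∀ x ∈ A, Adm x) ∧
      ∀ t : ZMod n, t.val.Coprime n → (pat A ε t ↔ (t = t₁ ∨ t = -t₁ ∨ t = t₂ ∨ t = -t₂)) := by
  have hne'' : t₁ ≠ -t₂ := fun h => hne' (by rw [h, neg_neg])
  by_cases h1 : t₁ = 1 ∨ t₁ = -1
  · have h2a : t₂ ≠ 1 := by
      rcases h1 with rfl | rfl
      · exact hne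
      · rwa [neg_neg] at hne'
    have h2b : t₂ ≠ -1 := by
      rcases h1 with rfl | rfl
      · exact hne'
      · exact hne
    obtain ⟨A, ε, hA, hP⟩ := hW t₂ h₂ h2a h2b
    refine ⟨A, ε, hA, fun t ht => ?_⟩
    rw [hP t ht]
    rcases h1 with rfl | rfl
    · exact Iff.rfl
    · rw [neg_neg]; tauto
  · push Not at h1
    by_cases h2 : t₂ = 1 ∨ t₂ = -1
    · obtain ⟨A, ε, hA, hP⟩ := hW t₁ h₁ h1.1 h1.2
      refine ⟨A, ε, hA, fun t ht => ?_⟩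
      rw [hP t ht]
      rcases h2 with rfl | rfl
      · tauto
      · rw [neg_neg]; tauto
    · push Not at h2
      obtain ⟨A₁, ε₁, hA₁, hP₁⟩ := hW t₁ h₁ h1.1 h1.2
      obtain ⟨A₂, ε₂, hA₂, hP₂⟩ := hW t₂ h₂ h2.1 h2.2
      refine ⟨A₁ ∆ A₂, xor ε₁ ε₂, adm_symmDiff hA₁ hA₂, fun t ht => ?_⟩
      rw [pat_symmDiff, hP₁ t ht, hP₂ t ht]
      obtain ⟨h11, h12⟩ := h1
      obtain ⟨h21, h22⟩ := h2
      have e1 : -t₁ ≠ 1 := fun h => h12 (by rw [← h, neg_neg])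
      have e2 : -t₁ ≠ -1 := fun h => h11 (neg_injective h)
      have e3 : -t₂ ≠ 1 := fun h => h22 (by rw [← h, neg_neg])
      have e4 : -t₂ ≠ -1 := fun h => h21 (neg_injective h)
      have e5 : -t₁ ≠ t₂ := fun h => hne' h.symm
      have e6 : -t₁ ≠ -t₂ := fun h => hne (neg_injective h).symm
      constructor
      · rintro (⟨ha, hb⟩ | ⟨ha, hb⟩) <;> tauto
      · rintro (rfl | rfl | rfl | rfl)
        · left
          exact ⟨by tauto, fun h => by rcases h with h | h | h | h; exacts [h11 h, h12 h, hne h.symm, hne'' h]⟩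
        · left
          exact ⟨by tauto, fun h => by rcases h with h | h | h | h; exacts [e1 h, e2 h, e5 h, e6 h]⟩
        · right
          exact ⟨by tauto, fun h => by rcases h with h | h | h | h; exacts [h21 h, h22 h, hne h, hne' h]⟩
        · right
          exact ⟨by tauto, fun h => by
            rcases h with h | h | h | h
            exacts [e3 h, e4 h, hne'' h.symm, hne (neg_injective h)]⟩

/-- **EVEN SUBSETS OF A CM TYPE SET ARE PATTERNS**: under `(W)`, for every CM type set `T` of `(ℤ/n)ˣ` and every
`J ⊆ T` with `|J|` even there is an admissible signed product `(A, ε)` with `pat A ε t ↔ (t ∈ J ∨ −t ∈ J)` for all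
unit residues `t` — the sign vector «negative exactly at the places under `J`».  Induction on `|J|`: peel a pair
`t₁, t₂ ∈ J` (§1 `exists_pattern_pair`; `t₂ ≠ −t₁` because `T ∌ −t₁`), add the patterns (`pat_symmDiff`); the
pieces are disjoint because `J ⊆ T` and `T` contains no opposite pair.
research route conditional on HC_CM; not a corollary; Q11.4-sentence-2 already refuted in dim ≥ 3. [folklore] -/
theorem exists_pattern_of_witnesses (hW : WitnessProperty) {T : Finset (ZMod n)} (hT : IsCMTypeSet n T)
    (J : Finset (ZMod n)) (hJT : J ⊆ T) (hJ : Even J.card) :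
    ∃ A : Finset (ℕ × ℕ × ℕ), ∃ ε : Bool, (∀ x ∈ A, Adm x) ∧
      ∀ t : ZMod n, t.val.Coprime n → (pat A ε t ↔ (t ∈ J ∨ -t ∈ J)) := by
  classical
  suffices hk : ∀ k : ℕ, ∀ J : Finset (ZMod n), J.card = k → J ⊆ T → Even k →
      ∃ A : Finset (ℕ × ℕ × ℕ), ∃ ε : Bool, (∀ x ∈ A, Adm x) ∧
        ∀ t : ZMod n, t.val.Coprime n → (pat A ε t ↔ (t ∈ J ∨ -t ∈ J)) from hk _ J rfl hJT hJ
  intro k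
  induction k using Nat.strong_induction_on with
  | _ k ih =>
    intro J hJk hJT hk
    obtain ⟨j, hj⟩ := hk
    rcases j with _ | j
    · -- `J = ∅`
      have hJ0 : J = ∅ := Finset.card_eq_zero.mp (by omega)
      refine ⟨∅, false, fun x hx => absurd hx (Finset.notMem_empty x), fun t _ => ?_⟩
      subst hJ0
      simp
    · -- peel a pair
      have hJne : J.Nonempty := Finset.card_pos.mp (by omega)
      obtain ⟨t₁, ht₁⟩ := hJne
      have hJ1 : (J.erase t₁).card = k - 1 := by rw [Finset.card_erase_of_mem ht₁, hJk]
      have hJ1ne : (J.erase t₁).Nonempty := Finset.card_pos.mp (by omega)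
      obtain ⟨t₂, ht₂⟩ := hJ1ne
      obtain ⟨ht₂₁, ht₂J⟩ := Finset.mem_erase.mp ht₂
      set J' := (J.erase t₁).erase t₂ with hJ'
      have hJ'card : J'.card = k - 2 := by rw [hJ', Finset.card_erase_of_mem ht₂, hJ1]; omega
      have hJ'T : J' ⊆ T := fun t ht =>
        hJT (Finset.mem_of_mem_erase (Finset.mem_of_mem_erase ht))
      obtain ⟨A', ε', hA', hP'⟩ := ih (k - 2) (by omega) J' hJ'card hJ'T ⟨j, by omega⟩
      have hu₁ : t₁.val.Coprime n := hT.1 t₁ (hJT ht₁)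
      have hu₂ : t₂.val.Coprime n := hT.1 t₂ (hJT ht₂J)
      have hnT₁ : -t₁ ∉ T := (hT.2 t₁ hu₁).mp (hJT ht₁)
      have hnT₂ : -t₂ ∉ T := (hT.2 t₂ hu₂).mp (hJT ht₂J)
      have hne' : t₂ ≠ -t₁ := fun h => hnT₁ (h ▸ hJT ht₂J)
      obtain ⟨A₂, ε₂, hA₂, hP₂⟩ := exists_pattern_pair hW hu₁ hu₂ ht₂₁ hne'
      refine ⟨A' ∆ A₂, xor ε' ε₂, adm_symmDiff hA' hA₂, fun t ht => ?_⟩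
      rw [pat_symmDiff, hP' t ht, hP₂ t ht]
      -- bookkeeping: `J = J' ⊔ {t₁, t₂}`, and `J' ⊆ T` meets no `±t₁, ±t₂`
      have m1 : t₁ ∉ J' := by rw [hJ']; simp
      have m2 : t₂ ∉ J' := by rw [hJ']; simp
      have m3 : -t₁ ∉ J' := fun h => hnT₁ (hJ'T h)
      have m4 : -t₂ ∉ J' := fun h => hnT₂ (hJ'T h)
      have hmem : ∀ s : ZMod n, s ∈ J ↔ (s ∈ J' ∨ s = t₁ ∨ s = t₂) := fun s => by
        rw [hJ', Finset.mem_erase, Finset.mem_erase]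
        constructor
        · intro hs
          by_cases e1 : s = t₁
          · exact Or.inr (Or.inl e1)
          · by_cases e2 : s = t₂
            · exact Or.inr (Or.inr e2)
            · exact Or.inl ⟨e2, e1, hs⟩
        · rintro (⟨-, -, hs⟩ | rfl | rfl)
          exacts [hs, ht₁, ht₂J]
      have hdis : (t ∈ J' ∨ -t ∈ J') → ¬ (t = t₁ ∨ t = -t₁ ∨ t = t₂ ∨ t = -t₂) := by
        rintro (hX | hX) hP
        · rcases hP with rfl | rfl | rfl | rfl
          exacts [m1 hX, m3 hX, m2 hX, m4 hX]
        · rcases hP with rfl | rfl | rfl | rfl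
          · exact m3 hX
          · rw [neg_neg] at hX; exact m1 hX
          · exact m4 hX
          · rw [neg_neg] at hX; exact m2 hX
      have hY : (t ∈ J ∨ -t ∈ J) ↔ ((t ∈ J' ∨ -t ∈ J') ∨ (t = t₁ ∨ t = -t₁ ∨ t = t₂ ∨ t = -t₂)) := by
        rw [hmem t, hmem (-t), neg_eq_iff_eq_neg (a := t) (b := t₁), neg_eq_iff_eq_neg (a := t) (b := t₂)]
        tauto
      rw [hY]
      constructor
      · rintro (⟨hX, -⟩ | ⟨hP, -⟩)
        exacts [Or.inl hX, Or.inr hP]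
      · rintro (hX | hP)
        · exact Or.inl ⟨hX, hdis hX⟩
        · by_cases hX : t ∈ J' ∨ -t ∈ J'
          · exact Or.inl ⟨hX, hdis hX⟩
          · exact Or.inr ⟨hP, hX⟩

/-! ### §2 THEOREM L (ii) and the census's YES verdicts from the witness property -/

variable {K : Type} [Field K] [NumberField K] {ζ : K}

open scoped Classical in
/-- **THEOREM L (ii) FROM `(W)`: every EVEN sign pattern on a CM type of `ℚ(ζₙ)` is a real unit's.**  For
`K = ℚ(ζₙ)` a CM field with the witness property `(W)`, every CM type `Φ` of `K` and every `S ⊆ Φ` with `|S|`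
even, there is a unit `u` of `𝓞 K` fixed by complex conjugation with `Re φ(u) < 0 ↔ φ ∈ S` for all `φ ∈ Φ`
(`u = ± ∏_{x∈A} ζ^{h_x}(1 − ζ^{a_x})(1 − ζ^{b_x})` of part 13, `(A, ε)` the pattern of the residues read by `S`,
§1).  This is the hypothesis `hU'` of part 7's `exists_principal_of_even`.
research route conditional on HC_CM; not a corollary; Q11.4-sentence-2 already refuted in dim ≥ 3. [cite: Washington1997, §8.1] -/
theorem exists_units_sign_eq [IsCMField K] [IsCyclotomicExtension {n} ℚ K] (hζ : IsPrimitiveRoot ζ n)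
    (hW : WitnessProperty) (Φ : CMType K) (S : Set (K →+* ℂ)) (hS : S ⊆ Φ.1) (hev : Even S.ncard) :
    ∃ u : (𝓞 K)ˣ, IsCMField.complexConj K ((u : 𝓞 K) : K) = ((u : 𝓞 K) : K) ∧
      ∀ φ ∈ Φ.1, ((φ ((u : 𝓞 K) : K)).re < 0 ↔ φ ∈ S) := by
  classical
  set T := Finset.univ.filter fun t : ZMod n => ∃ σ ∈ Φ.1, σ ζ = 𝐞 t with hTdef
  have hT : IsCMTypeSet n T := isCMTypeSet_residueFilter hζ Φ
  set J := Finset.univ.filter fun t : ZMod n => ∃ σ ∈ S, σ ζ = 𝐞 t with hJdef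
  have hJT : J ⊆ T := fun t ht => by
    obtain ⟨σ, hσ, hσt⟩ := (Finset.mem_filter.mp ht).2
    exact Finset.mem_filter.mpr ⟨Finset.mem_univ _, σ, hS hσ, hσt⟩
  have hJcard : J.card = S.ncard := by
    rw [← Set.ncard_coe_finset]
    symm
    refine Set.ncard_congr (fun ψ _ => Classical.choose (exists_apply_eq_toCircle hζ ψ)) ?_ ?_ ?_
    · intro ψ hψ
      obtain ⟨-, hread⟩ := Classical.choose_spec (exists_apply_eq_toCircle hζ ψ)
      simp only [Finset.coe_filter, Finset.mem_univ, true_and, Set.mem_setOf_eq, hJdef]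
      exact ⟨ψ, hψ, hread⟩
    · intro ψ ψ' _ _ h
      have h1 := (Classical.choose_spec (exists_apply_eq_toCircle hζ ψ)).2
      have h2 := (Classical.choose_spec (exists_apply_eq_toCircle hζ ψ')).2
      rw [h] at h1
      exact embedding_eq_of_apply_eq hζ (h1.trans h2.symm)
    · intro t ht
      simp only [Finset.coe_filter, Finset.mem_univ, true_and, Set.mem_setOf_eq, hJdef] at ht
      obtain ⟨σ, hσS, hσt⟩ := ht
      refine ⟨σ, hσS, ?_⟩
      have h1 := (Classical.choose_spec (exists_apply_eq_toCircle hζ σ)).2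
      exact ZMod.injective_toCircle (Circle.ext (h1.symm.trans hσt))
  obtain ⟨A, ε, hA, hP⟩ := exists_pattern_of_witnesses hW hT J hJT (hJcard ▸ hev)
  obtain ⟨u, hu, hconj⟩ := exists_units_coe_eq hζ hA ε
  refine ⟨u, hconj, fun φ hφ => ?_⟩
  obtain ⟨t, ht, hφt⟩ := exists_apply_eq_toCircle hζ φ
  have hA' : ∀ x ∈ A, ¬ n ∣ x.1 ∧ ¬ n ∣ x.2.1 ∧ (2 * x.2.2 + x.1 + x.2.1) % (2 * n) = 0 := fun x hx =>
    ⟨(hA x hx).1, (hA x hx).2.1, (hA x hx).2.2.1⟩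
  obtain ⟨hre, -⟩ := re_embedding_prod_neg_iff hφt ht A hA' ε
  rw [hu, hre, hP t ht]
  have htT : t ∈ T := Finset.mem_filter.mpr ⟨Finset.mem_univ _, φ, hφ, hφt⟩
  have hnt : -t ∉ T := (hT.2 t ht).mp htT
  constructor
  · rintro (h | h)
    · obtain ⟨σ, hσS, hσt⟩ := (Finset.mem_filter.mp h).2
      rwa [embedding_eq_of_apply_eq hζ (hφt.trans hσt.symm)]
    · exact absurd (hJT h) hnt
  · intro h
    exact Or.inl (Finset.mem_filter.mpr ⟨Finset.mem_univ _, φ, h, hφt⟩)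

open scoped Classical in
/-- **THE CENSUS'S YES VERDICTS FROM `(W)`** (kernel form, every level): for `K = ℚ(ζₙ)` a CM field with
`φ(n) = 2g` and the witness property `(W)`, every CM type `Φ` balanced for a CM type set `N_K`
(`2·|S_Φ ∩ N_K| = |S_Φ|`) whose `n₋ = #{t ∈ N_K : 2t < n}` is EVEN admits `ζ′ ∈ K` with `ζ′^ρ = −ζ′`,
`Im φ(ζ′) > 0` on `Φ`, and `CMTypeLattice.IsOfType 1 ζ′ ⊤`: the principal CM torus `ℂ^Φ/Φ(ℤ[ζₙ])` CARRIES an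
`ι`-compatible principal polarisation (part 7's `exists_principal_of_even` with `hU'` supplied by §2).
research route conditional on HC_CM; not a corollary; Q11.4-sentence-2 already refuted in dim ≥ 3. [cite: Shimura1998, §14.3 Prop. 5, p. 104] -/
theorem exists_principal_of_witnesses [IsCMField K] [IsCyclotomicExtension {n} ℚ K] (hζ : IsPrimitiveRoot ζ n)
    {k : ℕ} (hg : Nat.totient n = 2 * (k + 1)) (hW : WitnessProperty) (Φ : CMType K) {NK : Finset (ZMod n)}
    (hNK : IsCMTypeSet n NK)
    (hbal : 2 * ((Finset.univ.filter fun t : ZMod n => ∃ σ ∈ Φ.1, σ ζ = 𝐞 t) ∩ NK).card =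
      (Finset.univ.filter fun t : ZMod n => ∃ σ ∈ Φ.1, σ ζ = 𝐞 t).card)
    (heven : Even (NK.filter fun t : ZMod n => 2 * t.val < n).card) :
    ∃ ζ' : K, IsCMField.complexConj K ζ' = -ζ' ∧ (∀ φ : Φ.1, 0 < (φ.1 ζ').im) ∧
        CMTypeLattice.IsOfType (1 : (FractionalIdeal (𝓞 K)⁰ K)ˣ) ζ' ⊤ :=
  exists_principal_of_even hζ hg Φ hNK hbal heven fun S hS hev => exists_units_sign_eq hζ hW Φ S hS hev

end Summit.HodgeConjecture.Ring2WeilCoverage.CyclotomicUnitSignatures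

end
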